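import Literature.NumberTheory.Automorphic.AdelicUnitaryGroup             -- ★ `cmConjRingHom`, `embedding_cmConjRingHom` (`τ ∘ c = conj ∘ τ`)
import Literature.Geometry.ComplexHyperbolic.UnitBallU21                  -- ★ `BallModel.J = diag(1,1,-1)`, `det_J`
import Literature.AlgebraicGeometry.ShimuraVarieties.UnitaryBallCauchyRiemann  -- ★ `BallForms.conjTranspose_J` (`Jᴴ = J`)
import HarnessLib

/-!
# A CM frame `Tᴴ ι(H) T = diag(1,1,−1)` forces `H` to be hermitian with unit determinant

Topic `NumberTheory/Automorphic`; namespace `Literature.NumberTheory.Automorphic.UnitaryGroup`.  THEOREMS ONLY (no definition, no named fact, no instance, no notation,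
no `sorry`).  Cell `hodgecm-mathlib`, floor 0, programme P3: node N3′ of the statement tree of the letter (L2-SA) #85 `Rogawski1990.SemilocalCharactersLinIndep`
(`F0/P3/T1b-TREE.md`, seat typ-T1b); the last theorem `frame_hermitian_isUnit_det` is, token for token, the text of the stub `stub_frameHermitian` of the Lines draft
`F0/P3/Lines-draft/T1b_SemilocalCharactersLinIndep.lean` (closes it BY NAME).

THE MATHEMATICS (folklore linear algebra; the frames of [Rogawski1990, §12.1 p. 171]: `H ∈ M₃(L)` with `ι(H)` of signature `(2,1)`).  Let `L` be a CM field with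
conjugation `c` (★ `cmConjRingHom`), `ι : L →+* ℂ`, `H ∈ M₃(L)` and `T ∈ GL₃(ℂ)` with `Tᴴ ι(H) T = J`, `J = diag(1,1,−1)`.  Then `ι(H) = T⁻ᴴ J T⁻¹` is a hermitian
complex matrix (`Jᴴ = J`, ★ `BallForms.conjTranspose_J`), so `conj ι(H_{ji}) = ι(H_{ij})`; since `ι ∘ c = conj ∘ ι` (★ `embedding_cmConjRingHom`, Mathlib `IsCMField.complexEmbedding_complexConj`) and
`ι` is injective, `c(H_{ji}) = H_{ij}`, i.e. `ᵗ(c H) = H`.  And `det Tᴴ · ι(det H) · det T = det J = −1` forces `det H ≠ 0`.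

* `conjTranspose_map_eq_of_frame` (`ι(H)ᴴ = ι(H)`) · `transpose_map_cmConjRingHom_eq_of_frame` (`ᵗ(c H) = H`) ·
  `det_ne_zero_of_frame` · `frame_hermitian_isUnit_det` (the conjunction = the stub text).

## References
* J. D. Rogawski, *Automorphic Representations of Unitary Groups in Three Variables*, Ann. of Math. Stud. 123 (1990), §12.1 p. 171 [Rogawski1990].
-/

set_option autoImplicit false

noncomputable section

open NumberField
open scoped Matrix ComplexConjugate

namespace Literature.NumberTheory.Automorphic.UnitaryGroup

open Literature.Geometry.ComplexHyperbolic.BallModel (J det_J)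
open Literature.AlgebraicGeometry.ShimuraVarieties.BallForms (conjTranspose_J)

variable (L : Type) [Field L] [NumberField L] [IsCMField L] (ι : L →+* ℂ) (H : Matrix (Fin 3) (Fin 3) L) (T : GL (Fin 3) ℂ)

omit [NumberField L] [IsCMField L] in
/-- **The frame makes `ι(H)` hermitian**: `Tᴴ ι(H) T = J` with `T` invertible and `Jᴴ = J` give `ι(H)ᴴ = ι(H)` (apply `ᴴ` to the frame identity and cancel
the units `Tᴴ`, `T`). [folklore] [cite: Rogawski1990, §12.1 p. 171] -/
theorem conjTranspose_map_eq_of_frame (hT : (T : Matrix (Fin 3) (Fin 3) ℂ)ᴴ * H.map ι * (T : Matrix (Fin 3) (Fin 3) ℂ) = J) :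
    (H.map ι)ᴴ = H.map ι := by
  -- `ι(H) = T⁻ᴴ J T⁻¹`
  have hTu : IsUnit (T : Matrix (Fin 3) (Fin 3) ℂ) := Units.isUnit T
  have hTd : IsUnit (T : Matrix (Fin 3) (Fin 3) ℂ).det := (Matrix.isUnit_iff_isUnit_det _).1 hTu
  have hTHd : IsUnit ((T : Matrix (Fin 3) (Fin 3) ℂ)ᴴ).det := by
    rw [Matrix.det_conjTranspose]; exact hTd.star
  -- apply `ᴴ` to the frame identity
  have h1 : (T : Matrix (Fin 3) (Fin 3) ℂ)ᴴ * (H.map ι)ᴴ * (T : Matrix (Fin 3) (Fin 3) ℂ) = J := by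
    have := congrArg Matrix.conjTranspose hT
    rw [Matrix.conjTranspose_mul, Matrix.conjTranspose_mul, Matrix.conjTranspose_conjTranspose, conjTranspose_J,
      ← Matrix.mul_assoc] at this
    exact this
  have h2 : (T : Matrix (Fin 3) (Fin 3) ℂ)ᴴ * (H.map ι)ᴴ * (T : Matrix (Fin 3) (Fin 3) ℂ) =
      (T : Matrix (Fin 3) (Fin 3) ℂ)ᴴ * H.map ι * (T : Matrix (Fin 3) (Fin 3) ℂ) := by rw [h1, hT]
  -- cancel `T` on the right and `Tᴴ` on the left
  have h3 : (T : Matrix (Fin 3) (Fin 3) ℂ)ᴴ * (H.map ι)ᴴ = (T : Matrix (Fin 3) (Fin 3) ℂ)ᴴ * H.map ι := by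
    have := congrArg (· * (T : Matrix (Fin 3) (Fin 3) ℂ)⁻¹) h2
    simpa only [Matrix.mul_nonsing_inv_cancel_right _ _ hTd] using this
  have h4 := congrArg (((T : Matrix (Fin 3) (Fin 3) ℂ)ᴴ)⁻¹ * ·) h3
  simpa only [Matrix.nonsing_inv_mul_cancel_left _ _ hTHd] using h4

/-- **The frame makes `H` hermitian for the CM conjugation**: `ᵗ(c H) = H` (from `ι(H)ᴴ = ι(H)`, `ι ∘ c = conj ∘ ι` ★ `embedding_cmConjRingHom`, and injectivity
of `ι`). [folklore] [cite: Rogawski1990, §12.1 p. 171] -/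
theorem transpose_map_cmConjRingHom_eq_of_frame (hT : (T : Matrix (Fin 3) (Fin 3) ℂ)ᴴ * H.map ι * (T : Matrix (Fin 3) (Fin 3) ℂ) = J) :
    (H.map (cmConjRingHom L))ᵀ = H := by
  have h := conjTranspose_map_eq_of_frame L ι H T hT
  ext i j
  have hij := congrFun (congrFun h i) j
  rw [Matrix.conjTranspose_apply, Matrix.map_apply, Matrix.map_apply] at hij
  rw [Matrix.transpose_apply, Matrix.map_apply]
  apply ι.injective
  rw [embedding_cmConjRingHom, starRingEnd_apply]
  exact hij

omit [NumberField L] [IsCMField L] in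
/-- **The frame makes `H` non-degenerate**: `det Tᴴ · ι(det H) · det T = det J = −1`, so `det H ≠ 0`. [folklore] [cite: Rogawski1990, §12.1 p. 171] -/
theorem det_ne_zero_of_frame (hT : (T : Matrix (Fin 3) (Fin 3) ℂ)ᴴ * H.map ι * (T : Matrix (Fin 3) (Fin 3) ℂ) = J) : H.det ≠ 0 := by
  intro h0
  have hdet : (H.map ι).det = ι H.det := by rw [RingHom.map_det, RingHom.mapMatrix_apply]
  have h := congrArg Matrix.det hT
  rw [Matrix.det_mul, Matrix.det_mul, hdet, h0, map_zero, mul_zero, zero_mul, det_J] at h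
  norm_num at h

/-- **STUB TEXT `stub_frameHermitian` of the #85 Lines draft, PROVED**: a CM frame `Tᴴ ι(H) T = J` forces `ᵗ(c H) = H` and `det H` a unit.
[folklore] [cite: Rogawski1990, §12.1 p. 171] -/
theorem frame_hermitian_isUnit_det (hT : (T : Matrix (Fin 3) (Fin 3) ℂ)ᴴ * H.map ι * (T : Matrix (Fin 3) (Fin 3) ℂ) = J) :
    (H.map (cmConjRingHom L))ᵀ = H ∧ IsUnit H.det :=
  ⟨transpose_map_cmConjRingHom_eq_of_frame L ι H T hT, isUnit_iff_ne_zero.2 (det_ne_zero_of_frame L ι H T hT)⟩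

end Literature.NumberTheory.Automorphic.UnitaryGroup

end
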